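import Summits.QuantumFields.BalabanUV.T4Continuum.Spine.NE3.FrameNormalisationOneLevel
import Summits.QuantumFields.BalabanUV.T4Continuum.Support.GaugeFieldPerturbation
import HarnessLib

/-!
# T⁴ programme, node NE3 — census R50 open half (M1), EIGHTH BRICK: the twisted exponent is LIPSCHITZ JOINTLY in the perturbation and in the twist — `‖F_a[X] − F_b[X′]‖ ≤
# (1+ρ∕(1−ρ))·((1+t)·ε + (1+η)·d·L·ε_X)` (`FrameNormalisationFrameLipschitz`)

Cell `pub-balaban-gaps` (track G2, seat ne3, generation 11), row NE3; census `HOME/ne/NE3.md` §4 R50, §17 (M1).  The contraction of (M1) iterates, level by level, the map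
`(Dʲ, corner data) ↦ D^{j+1}` of the twisted tower (`FrameNormalisationTower` ∕ `…TowerExists`); its Lipschitz letter needs the twisted exponent
`F(y) = Σ_r L^{−d} log[(R_{0,y}X)(Γ_{y,y+r})·a_r]` to be Lipschitz in BOTH arguments: the twist `a_r` (brick 6, `FrameNormalisationDefectLipschitz`) AND the perturbation `X`
(this brick).  Elementary:

* §1 `norm_tHol_sub_tHol_le` — the twisted holonomy (58) is `|Γ|`-Lipschitz in the perturbation: `‖(R_{0,y}X)(Γ) − (R_{0,y}X′)(Γ)‖ ≤ |Γ|·sup_b‖X(b) − X′(b)‖` for `U1`-valued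
  `V₀, X, X′` (`tHol = hol(X·V₀)·hol(V₀)⁻¹`; `GaugeFieldPerturbation.norm_hol_sub_hol_le_of_forall`).
* §2 `norm_twistedSum_sub_twistedSum_le₂` — abstract: `‖T_r − 1‖, ‖T′_r − 1‖ ≤ t`, `‖a_r − 1‖, ‖b_r − 1‖ ≤ η`, `t + (1+t)η ≤ ρ < 1`, `‖T_r − T′_r‖ ≤ θ`, `‖a_r − b_r‖ ≤ ε` ⟹
  **`‖Σ_r L^{−d} log[T_r a_r] − Σ_r L^{−d} log[T′_r b_r]‖ ≤ (1+ρ∕(1−ρ))·((1+t)·ε + (1+η)·θ)`**.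
* §3 **`norm_twistedSum_sub_twistedSum_le_joint`** — the instance `T_r = (R_{0,y}X)(Γ_r)`, `T′_r = (R_{0,y}X′)(Γ_r)` on the block tree contours (`θ = d·L·ε_X` by §1 and
  `l1_boxVec_le`), abstract twists `a_r, b_r`: the joint Lipschitz letter.

HONEST FRAMING (page 1).  Elementary estimates on OUR objects (0 def, 0 sorry); the contraction through the `k` levels and the smooth interpolant are NOT done; nothing of
Bałaban's asserted; **NE3 NOT proved**; `PairLandauGaugeB8Avg` and the covariant root NOT proved; spine PROVED 0∕9; finite T⁴ rung (B)+1 — NOT continuum YM on ℝ⁴, NOT infinite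
volume, NOT mass gap, NOT `BetaPertH`, NOT Clay.  HONEST DEPENDENCY: continuum YM on T⁴ ⇐ BetaPertH ∧ nine spine estimates (0/9 proved); BetaPertH ⇐ (D1) ∧ (D4) ∧ CAP+tail;
G-an2-4 gates asym, D1 and NE2/3/4.  PLACEMENT: `Summits/QuantumFields/BalabanUV/T4Continuum/Spine/NE3/`; imports `FrameNormalisationOneLevel` and `Support/GaugeFieldPerturbation`.

References: [Balaban1985Averaging] T. Bałaban, *Averaging operations for lattice gauge theories*, CMP 98 (1985) 17–51: (9) p. 18, (21) p. 21, (58) p. 27, (62) p. 28, (82) p. 30.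
-/

set_option autoImplicit false

open scoped BigOperators Matrix Matrix.Norms.L2Operator
open NormedSpace

namespace Summit.QuantumFields.BalabanUV.T4Continuum.NE3.FrameNormalisationFrameLipschitz

open Literature.MathematicalPhysics.QuantumFieldTheory.Balaban1983to89
open B7Prop1Explicit B7Prop2Explicit MatrixLog
open B7Eq92Concrete (Rc Rc_apply tHol)
open FederbushMean (norm_mlog_sub_mlog_le)
open GaugeFieldPerturbation (norm_hol_sub_hol_le_of_forall)

noncomputable section

variable {d : ℕ} {n : Type*} [Fintype n] [DecidableEq n]

/-! ## §1 The twisted holonomy is Lipschitz in the perturbation -/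

/-- **`‖(R_{0,y}X)(Γ) − (R_{0,y}X′)(Γ)‖ ≤ |Γ|·ε_X`** for `U1`-valued `V₀, X, X′` with `‖X(b) − X′(b)‖ ≤ ε_X` on every bond ((58): `(R_{0,y}X)(Γ) = (X·V₀)(Γ)·V₀(Γ)⁻¹`; the
transport is `1`-Lipschitz in every bond it visits and `‖V₀(Γ)⁻¹‖ ≤ 1`). [folklore] -/
theorem norm_tHol_sub_tHol_le [Nonempty n] {V₀ X X' : Site d → Fin d → (Matrix n n ℂ)ˣ} {εX : ℝ}
    (hV₀ : ∀ (x : Site d) (κ : Fin d), V₀ x κ ∈ U1 (Matrix n n ℂ)) (hX : ∀ (x : Site d) (κ : Fin d), X x κ ∈ U1 (Matrix n n ℂ))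
    (hX' : ∀ (x : Site d) (κ : Fin d), X' x κ ∈ U1 (Matrix n n ℂ))
    (hε : ∀ (x : Site d) (κ : Fin d), ‖((X x κ : (Matrix n n ℂ)ˣ) : Matrix n n ℂ) - ((X' x κ : (Matrix n n ℂ)ˣ) : Matrix n n ℂ)‖ ≤ εX)
    (y : Site d) (w : List (Letter d)) :
    ‖((tHol V₀ X y w : (Matrix n n ℂ)ˣ) : Matrix n n ℂ) - ((tHol V₀ X' y w : (Matrix n n ℂ)ˣ) : Matrix n n ℂ)‖ ≤ (w.length : ℝ) * εX := by
  have hXV : ∀ (x : Site d) (κ : Fin d), (X * V₀) x κ ∈ U1 (Matrix n n ℂ) := fun x κ => (U1 _).mul_mem (hX x κ) (hV₀ x κ)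
  have hXV' : ∀ (x : Site d) (κ : Fin d), (X' * V₀) x κ ∈ U1 (Matrix n n ℂ) := fun x κ => (U1 _).mul_mem (hX' x κ) (hV₀ x κ)
  have hb : ∀ (x : Site d) (κ : Fin d),
      ‖(((X * V₀) x κ : (Matrix n n ℂ)ˣ) : Matrix n n ℂ) - (((X' * V₀) x κ : (Matrix n n ℂ)ˣ) : Matrix n n ℂ)‖ ≤ εX := by
    intro x κ
    simp only [Pi.mul_apply, Units.val_mul]
    rw [← sub_mul]
    calc _ ≤ ‖((X x κ : (Matrix n n ℂ)ˣ) : Matrix n n ℂ) - ((X' x κ : (Matrix n n ℂ)ˣ) : Matrix n n ℂ)‖ * ‖((V₀ x κ : (Matrix n n ℂ)ˣ) : Matrix n n ℂ)‖ :=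
          norm_mul_le _ _
      _ ≤ εX * 1 := mul_le_mul (hε x κ) (mem_U1.mp (hV₀ x κ)).1 (norm_nonneg _) ((norm_nonneg _).trans (hε x κ))
      _ = εX := mul_one εX
  have hh := norm_hol_sub_hol_le_of_forall hXV' hXV hb y w
  have hinv : ‖(((hol V₀ y w)⁻¹ : (Matrix n n ℂ)ˣ) : Matrix n n ℂ)‖ ≤ 1 := (mem_U1.mp (hol_mem hV₀ y w)).2
  unfold tHol
  rw [Units.val_mul, Units.val_mul, ← sub_mul]
  calc _ ≤ ‖((hol (X * V₀) y w : (Matrix n n ℂ)ˣ) : Matrix n n ℂ) - ((hol (X' * V₀) y w : (Matrix n n ℂ)ˣ) : Matrix n n ℂ)‖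
          * ‖(((hol V₀ y w)⁻¹ : (Matrix n n ℂ)ˣ) : Matrix n n ℂ)‖ := norm_mul_le _ _
    _ ≤ ((w.length : ℝ) * εX) * 1 :=
        mul_le_mul hh hinv (norm_nonneg _) ((norm_nonneg _).trans hh)
    _ = (w.length : ℝ) * εX := mul_one _

/-! ## §2 The twisted exponent is Lipschitz jointly in the holonomies and in the twist -/

/-- **JOINT LIPSCHITZ LETTER (abstract)**: `‖Σ_r L^{−d} log[T_r a_r] − Σ_r L^{−d} log[T′_r b_r]‖ ≤ (1+ρ∕(1−ρ))·((1+t)·ε + (1+η)·θ)`. [folklore] -/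
theorem norm_twistedSum_sub_twistedSum_le₂ [Nonempty n] (L : ℕ) (T T' a b : (Fin d → Fin L) → (Matrix n n ℂ)ˣ)
    {t η ρ ε θ : ℝ} (ht : 0 ≤ t) (hη : 0 ≤ η) (hε : 0 ≤ ε) (hθ : 0 ≤ θ) (hρ : t + (1 + t) * η ≤ ρ) (hρ1 : ρ < 1)
    (hT : ∀ r, ‖((T r : (Matrix n n ℂ)ˣ) : Matrix n n ℂ) - 1‖ ≤ t) (hT' : ∀ r, ‖((T' r : (Matrix n n ℂ)ˣ) : Matrix n n ℂ) - 1‖ ≤ t)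
    (ha : ∀ r, ‖((a r : (Matrix n n ℂ)ˣ) : Matrix n n ℂ) - 1‖ ≤ η) (hb : ∀ r, ‖((b r : (Matrix n n ℂ)ˣ) : Matrix n n ℂ) - 1‖ ≤ η)
    (hTT : ∀ r, ‖((T r : (Matrix n n ℂ)ˣ) : Matrix n n ℂ) - ((T' r : (Matrix n n ℂ)ˣ) : Matrix n n ℂ)‖ ≤ θ)
    (hab : ∀ r, ‖((a r : (Matrix n n ℂ)ˣ) : Matrix n n ℂ) - ((b r : (Matrix n n ℂ)ˣ) : Matrix n n ℂ)‖ ≤ ε) :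
    ‖(∑ r : Fin d → Fin L, (((L : ℝ) ^ d)⁻¹) • mlog (((T r * a r : (Matrix n n ℂ)ˣ)) : Matrix n n ℂ))
      - ∑ r : Fin d → Fin L, (((L : ℝ) ^ d)⁻¹) • mlog (((T' r * b r : (Matrix n n ℂ)ˣ)) : Matrix n n ℂ)‖
      ≤ (1 + ρ / (1 - ρ)) * ((1 + t) * ε + (1 + η) * θ) := by
  set K : ℝ := (1 + ρ / (1 - ρ)) * ((1 + t) * ε + (1 + η) * θ) with hK
  have hρ0 : 0 ≤ ρ := le_trans (by positivity) hρ
  have hlip : 0 ≤ 1 + ρ / (1 - ρ) := by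
    have : 0 ≤ ρ / (1 - ρ) := div_nonneg hρ0 (by linarith)
    linarith
  have hK0 : 0 ≤ K := by positivity
  have hnorm1 : ∀ (Z : Matrix n n ℂ) (s : ℝ), ‖Z - 1‖ ≤ s → ‖Z‖ ≤ 1 + s := by
    intro Z s hZ
    have h := norm_le_norm_add_norm_sub' Z 1
    rw [norm_one] at h
    linarith
  have hball : ∀ (Z c : Matrix n n ℂ), ‖Z - 1‖ ≤ t → ‖c - 1‖ ≤ η → ‖Z * c - 1‖ ≤ ρ := by
    intro Z c hZ hc
    have h1 : Z * c - 1 = Z * (c - 1) + (Z - 1) := by rw [mul_sub, mul_one]; abel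
    rw [h1]
    calc _ ≤ ‖Z * (c - 1)‖ + ‖Z - 1‖ := norm_add_le _ _
      _ ≤ (1 + t) * η + t := add_le_add ((norm_mul_le _ _).trans (mul_le_mul (hnorm1 Z t hZ) hc (norm_nonneg _) (by linarith))) hZ
      _ ≤ ρ := by linarith
  have hterm : ∀ r : Fin d → Fin L,
      ‖mlog (((T r * a r : (Matrix n n ℂ)ˣ)) : Matrix n n ℂ) - mlog (((T' r * b r : (Matrix n n ℂ)ˣ)) : Matrix n n ℂ)‖ ≤ K := by
    intro r
    rw [Units.val_mul, Units.val_mul]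
    have hdiff : ‖((T r : (Matrix n n ℂ)ˣ) : Matrix n n ℂ) * (a r : Matrix n n ℂ) - ((T' r : (Matrix n n ℂ)ˣ) : Matrix n n ℂ) * (b r : Matrix n n ℂ)‖
        ≤ (1 + t) * ε + (1 + η) * θ := by
      have h1 : ((T r : (Matrix n n ℂ)ˣ) : Matrix n n ℂ) * (a r : Matrix n n ℂ) - ((T' r : (Matrix n n ℂ)ˣ) : Matrix n n ℂ) * (b r : Matrix n n ℂ)
          = ((T r : (Matrix n n ℂ)ˣ) : Matrix n n ℂ) * ((a r : Matrix n n ℂ) - (b r : Matrix n n ℂ))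
            + (((T r : (Matrix n n ℂ)ˣ) : Matrix n n ℂ) - ((T' r : (Matrix n n ℂ)ˣ) : Matrix n n ℂ)) * (b r : Matrix n n ℂ) := by
        rw [mul_sub, sub_mul]; abel
      rw [h1]
      calc _ ≤ ‖((T r : (Matrix n n ℂ)ˣ) : Matrix n n ℂ) * ((a r : Matrix n n ℂ) - (b r : Matrix n n ℂ))‖
              + ‖(((T r : (Matrix n n ℂ)ˣ) : Matrix n n ℂ) - ((T' r : (Matrix n n ℂ)ˣ) : Matrix n n ℂ)) * (b r : Matrix n n ℂ)‖ := norm_add_le _ _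
        _ ≤ (1 + t) * ε + θ * (1 + η) := by
            refine add_le_add ?_ ?_
            · exact (norm_mul_le _ _).trans (mul_le_mul (hnorm1 _ t (hT r)) (hab r) (norm_nonneg _) (by linarith))
            · exact (norm_mul_le _ _).trans (mul_le_mul (hTT r) (hnorm1 _ η (hb r)) (norm_nonneg _) hθ)
        _ = (1 + t) * ε + (1 + η) * θ := by ring
    calc _ ≤ (1 + ρ / (1 - ρ)) * ‖((T r : (Matrix n n ℂ)ˣ) : Matrix n n ℂ) * (a r : Matrix n n ℂ)
              - ((T' r : (Matrix n n ℂ)ˣ) : Matrix n n ℂ) * (b r : Matrix n n ℂ)‖ :=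
          norm_mlog_sub_mlog_le hρ1 (hball _ _ (hT r) (ha r)) (hball _ _ (hT' r) (hb r))
      _ ≤ K := mul_le_mul_of_nonneg_left hdiff hlip
  rw [← Finset.sum_sub_distrib]
  have hc0 : 0 ≤ ((L : ℝ) ^ d)⁻¹ := by positivity
  calc ‖∑ r : Fin d → Fin L, ((((L : ℝ) ^ d)⁻¹) • mlog (((T r * a r : (Matrix n n ℂ)ˣ)) : Matrix n n ℂ)
          - (((L : ℝ) ^ d)⁻¹) • mlog (((T' r * b r : (Matrix n n ℂ)ˣ)) : Matrix n n ℂ))‖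
      ≤ ∑ r : Fin d → Fin L, ((L : ℝ) ^ d)⁻¹ * K := by
        refine (norm_sum_le _ _).trans (Finset.sum_le_sum fun r _ => ?_)
        rw [← smul_sub, norm_smul, Real.norm_of_nonneg hc0]
        exact mul_le_mul_of_nonneg_left (hterm r) hc0
    _ = ((Fintype.card (Fin d → Fin L) : ℝ) * ((L : ℝ) ^ d)⁻¹) * K := by
        rw [Finset.sum_const, nsmul_eq_mul, Finset.card_univ, mul_assoc]
    _ ≤ 1 * K := by
        refine mul_le_mul_of_nonneg_right ?_ hK0
        rw [Fintype.card_fun, Fintype.card_fin, Fintype.card_fin, Nat.cast_pow]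
        exact mul_inv_le_one
    _ = K := one_mul K

/-! ## §3 The joint Lipschitz letter on the block tree contours -/

/-- **JOINT LIPSCHITZ LETTER OF THE TWISTED EXPONENT** in the perturbation (`X` vs `X′`, `U1`-valued, `ε_X`-close bondwise, twisted holonomies within `t` of `1`) and in the twist
(`a_r` vs `b_r`, within `η` of `1`, `ε`-close), `t + (1+t)η ≤ ρ < 1`:
`‖Σ_r L^{−d} log[(R_{0,y}X)(Γ_r)·a_r] − Σ_r L^{−d} log[(R_{0,y}X′)(Γ_r)·b_r]‖ ≤ (1+ρ∕(1−ρ))·((1+t)·ε + (1+η)·d·L·ε_X)`. [folklore] -/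
theorem norm_twistedSum_sub_twistedSum_le_joint [Nonempty n] (L : ℕ) {V₀ X X' : Site d → Fin d → (Matrix n n ℂ)ˣ} (a b : (Fin d → Fin L) → (Matrix n n ℂ)ˣ)
    (y : Site d) {t η ρ ε εX : ℝ} (ht : 0 ≤ t) (hη : 0 ≤ η) (hε : 0 ≤ ε) (hεX : 0 ≤ εX) (hρ : t + (1 + t) * η ≤ ρ) (hρ1 : ρ < 1)
    (hV₀ : ∀ (x : Site d) (κ : Fin d), V₀ x κ ∈ U1 (Matrix n n ℂ)) (hX : ∀ (x : Site d) (κ : Fin d), X x κ ∈ U1 (Matrix n n ℂ))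
    (hX' : ∀ (x : Site d) (κ : Fin d), X' x κ ∈ U1 (Matrix n n ℂ))
    (hεX' : ∀ (x : Site d) (κ : Fin d), ‖((X x κ : (Matrix n n ℂ)ˣ) : Matrix n n ℂ) - ((X' x κ : (Matrix n n ℂ)ˣ) : Matrix n n ℂ)‖ ≤ εX)
    (hT : ∀ r : Fin d → Fin L, ‖((tHol V₀ X y (treeWord (boxVec L r)) : (Matrix n n ℂ)ˣ) : Matrix n n ℂ) - 1‖ ≤ t)
    (hT' : ∀ r : Fin d → Fin L, ‖((tHol V₀ X' y (treeWord (boxVec L r)) : (Matrix n n ℂ)ˣ) : Matrix n n ℂ) - 1‖ ≤ t)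
    (ha : ∀ r, ‖((a r : (Matrix n n ℂ)ˣ) : Matrix n n ℂ) - 1‖ ≤ η) (hb : ∀ r, ‖((b r : (Matrix n n ℂ)ˣ) : Matrix n n ℂ) - 1‖ ≤ η)
    (hab : ∀ r, ‖((a r : (Matrix n n ℂ)ˣ) : Matrix n n ℂ) - ((b r : (Matrix n n ℂ)ˣ) : Matrix n n ℂ)‖ ≤ ε) :
    ‖(∑ r : Fin d → Fin L, (((L : ℝ) ^ d)⁻¹) • mlog (((tHol V₀ X y (treeWord (boxVec L r)) * a r : (Matrix n n ℂ)ˣ)) : Matrix n n ℂ))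
      - ∑ r : Fin d → Fin L, (((L : ℝ) ^ d)⁻¹) • mlog (((tHol V₀ X' y (treeWord (boxVec L r)) * b r : (Matrix n n ℂ)ˣ)) : Matrix n n ℂ)‖
      ≤ (1 + ρ / (1 - ρ)) * ((1 + t) * ε + (1 + η) * ((d : ℝ) * L * εX)) := by
  refine norm_twistedSum_sub_twistedSum_le₂ L (fun r => tHol V₀ X y (treeWord (boxVec L r))) (fun r => tHol V₀ X' y (treeWord (boxVec L r))) a b
    ht hη hε (by positivity) hρ hρ1 hT hT' ha hb (fun r => ?_) hab
  have h := norm_tHol_sub_tHol_le hV₀ hX hX' hεX' y (treeWord (boxVec L r))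
  rw [length_treeWord] at h
  refine h.trans (mul_le_mul_of_nonneg_right ?_ hεX)
  exact_mod_cast l1_boxVec_le (r := r)

end

end Summit.QuantumFields.BalabanUV.T4Continuum.NE3.FrameNormalisationFrameLipschitz
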